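import Summits.ValiantsHypothesis.ValiantsHypothesis.Theorems.KPlusLogSqLawValuativeDoorRankOneDomCount

/-!
# LINE `valuative_door` (crux `WeakLifting`, stmt-ValiantsHypothesis-19561) — the VALUATED-MATROID EXCHANGE of the rank-one
# lacunary pencil (Grassmann–Plücker via Cramer, non-archimedean form)

HONEST FRAMING.  Helper (cell `pub-symmetroid`, seat val-sym-lift-p1 g22, 2026-08-29; `--supports 19561 --as helper`).  Toward the line's
content rung `stub_valRankOneLaw` / the calibration target `ValRankOneSharp` WITHOUT the unit-minor («modular») hypothesis of the landed
`ValRankOneSharpModularDiss` (p700449): the coefficients `c_S = ε(S) · det(u_S)²` of the rank-one determinant `det Σ_l X^{d_l} ε_l u_l u_lᵀ`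
(`det_rankOnePencil`, Cauchy–Binet; `S` an `m`-subset of the letters, dissociated `d`) satisfy, for every NON-ARCHIMEDEAN absolute value
`v`, the exchange inequality of a valuated matroid (Dress–Wenzel): for `m`-sets `A`, `B` with `c_A c_B ≠ 0` and `i ∈ A \ B` there is
`j ∈ B \ A` with `v(c_A) v(c_B) ≤ v(c_{A−i+j}) v(c_{B−j+i})` (`exchange_coeff_rankOnePencil`).  Source of the inequality: the
Grassmann–Plücker relation `det U_A · det U_B = Σ_j det U_A[i ← u_j] · det U_B[j ← u_i]`, derived here from CRAMER's rule
(`Matrix.mulVec_cramer`: apply the `i`-th Cramer coordinate w.r.t. `U_A` to `U_B · cramer U_B u_i = det U_B · u_i`;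
`det_mul_det_eq_sum_updateCol`; the tree's `…TowerRecord.gp_rows` is the row form over `ℂ[X]`), plus the ultrametric inequality on the finite sum (`IsNonarchimedean.finset_image_add_of_nonempty`).
Bookkeeping: updated column selections (`updateCol_colSel`), repeated columns (`det_colSel_update_eq_zero`), and invariance of `v ∘ det`
under re-ordering a column selection (`absdet_colSel_eq_of_image_eq`, `Matrix.det_permute'`).  Nothing here is a stub of the line or closes
anything; no bearing on vW / vB, `TropicalB`, `MatrixDescartes` (18050) or VP ≠ VNP.  [folklore: Grassmann–Plücker / Dress–Wenzel 1992]
-/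

set_option linter.dupNamespace false
set_option autoImplicit false

namespace Summit.ValiantsHypothesis.ValiantsHypothesis.Theorems.KPlusLogSqLaw.ValDoor

open Polynomial Finset Matrix
open scoped BigOperators Classical

variable {F : Type*} [Field F]

/-! ## §1 Grassmann–Plücker via Cramer -/

/-- **Grassmann–Plücker from Cramer:** `det A · det B = Σ_j det A[c ← B_j] · det B[j ← A_c]` (columns).  Apply the linear functional
`x ↦ cramer A x c = det A[c ← x]` to Cramer's identity `B · cramer B A_c = det B · A_c`.  (Sibling in the tree: the ROW form over `ℂ[X]`,
`…NewtonUnitEquations.TwoProducts.TowerRecord.gp_rows`.) [folklore] -/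
theorem det_mul_det_eq_sum_updateCol {m : ℕ} (A B : Matrix (Fin m) (Fin m) F) (c : Fin m) :
    A.det * B.det = ∑ j, (A.updateCol c fun r => B r j).det * (B.updateCol j fun r => A r c).det := by
  set a : Fin m → F := fun r => A r c with ha
  -- a matrix–vector product is the combination of the columns
  have hcol : B *ᵥ B.cramer a = ∑ j, B.cramer a j • (fun r => B r j) := by
    funext r
    simp only [Matrix.mulVec, dotProduct, Finset.sum_apply, Pi.smul_apply, smul_eq_mul]
    exact Finset.sum_congr rfl fun j _ => mul_comm _ _
  have h1 : B *ᵥ B.cramer a = B.det • a := B.mulVec_cramer a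
  have h2 : A.cramer (B *ᵥ B.cramer a) c = B.det * A.det := by
    rw [h1, map_smul, Pi.smul_apply, smul_eq_mul, cramer_apply, ha, updateCol_eq_self]
  have h3 : A.cramer (B *ᵥ B.cramer a) c = ∑ j, (A.updateCol c fun r => B r j).det * (B.updateCol j a).det := by
    rw [hcol, map_sum, Finset.sum_apply]
    refine Finset.sum_congr rfl fun j _ => ?_
    rw [map_smul, Pi.smul_apply, smul_eq_mul, cramer_apply, cramer_apply, mul_comm]
  rw [mul_comm, ← h2, h3]

/-- **non-archimedean Grassmann–Plücker:** for a non-archimedean absolute value some exchange term dominates the product: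
`v(det A) v(det B) ≤ v(det A[c ← B_j]) v(det B[j ← A_c])` for some column `j`. [folklore: ultrametric inequality on the GP sum] -/
theorem exists_absdet_mul_le_exchange (v : AbsoluteValue F ℝ) (hv : IsNonarchimedean v) {m : ℕ} (hm : 0 < m)
    (A B : Matrix (Fin m) (Fin m) F) (c : Fin m) :
    ∃ j : Fin m, v A.det * v B.det ≤ v (A.updateCol c fun r => B r j).det * v (B.updateCol j fun r => A r c).det := by
  have hne : (Finset.univ : Finset (Fin m)).Nonempty := ⟨⟨0, hm⟩, Finset.mem_univ _⟩
  obtain ⟨j, -, hj⟩ := IsNonarchimedean.finset_image_add_of_nonempty hv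
    (fun j => (A.updateCol c fun r => B r j).det * (B.updateCol j fun r => A r c).det) hne
  refine ⟨j, ?_⟩
  rw [← map_mul, det_mul_det_eq_sum_updateCol A B c, ← map_mul]
  exact hj

/-! ## §2 Column selections `U_t = (u_{t c})_c` -/

omit [Field F] in
/-- updating column `c` of a column selection by the column `u_j` is the selection updated at `c`. [bookkeeping] -/
theorem updateCol_colSel {m K : ℕ} (u : Fin K → Fin m → F) (t : Fin m → Fin K) (c : Fin m) (j : Fin K) :
    (Matrix.of fun r c' => u (t c') r).updateCol c (fun r => u j r) = Matrix.of fun r c' => u (Function.update t c j c') r := by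
  ext r c'
  rw [updateCol_apply, of_apply, of_apply]
  by_cases h : c' = c
  · subst h
    rw [if_pos rfl, Function.update_self]
  · rw [if_neg h, Function.update_of_ne h]

/-- a column selection hitting the new letter elsewhere has a repeated column after the update: determinant `0`. [bookkeeping] -/
theorem det_colSel_update_eq_zero {m K : ℕ} (u : Fin K → Fin m → F) (t : Fin m → Fin K) (c c₀ : Fin m) (hc : c₀ ≠ c)
    (j : Fin K) (hj : t c₀ = j) :
    (Matrix.of fun r c' => u (Function.update t c j c') r).det = 0 := by
  refine Matrix.det_zero_of_column_eq hc fun r => ?_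
  rw [of_apply, of_apply, Function.update_of_ne hc, Function.update_self, hj]

/-- `v ∘ det` of a column selection depends only on the SET of selected letters (re-ordering = a column permutation, sign `±1`).
[bookkeeping: `Matrix.det_permute'`] -/
theorem absdet_colSel_eq_of_image_eq (v : AbsoluteValue F ℝ) {m K : ℕ} (u : Fin K → Fin m → F) {t t' : Fin m → Fin K}
    (ht : Function.Injective t) (h : univ.image t = univ.image t') :
    v (Matrix.of fun r c => u (t c) r).det = v (Matrix.of fun r c => u (t' c) r).det := by
  have hex : ∀ c : Fin m, ∃ c' : Fin m, t' c' = t c := by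
    intro c
    have hc : t c ∈ univ.image t' := h ▸ Finset.mem_image_of_mem t (Finset.mem_univ c)
    obtain ⟨c', _, hc'⟩ := Finset.mem_image.1 hc
    exact ⟨c', hc'⟩
  choose σ hσ using hex
  have hσinj : Function.Injective σ := by
    intro c₁ c₂ h12
    apply ht
    rw [← hσ c₁, ← hσ c₂, h12]
  have hσbij : Function.Bijective σ := Finite.injective_iff_bijective.1 hσinj
  set e : Equiv.Perm (Fin m) := Equiv.ofBijective σ hσbij with he
  have hsub : (Matrix.of fun r c => u (t c) r) = (Matrix.of fun r c => u (t' c) r).submatrix id e := by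
    ext r c
    simp only [submatrix_apply, of_apply, id, he, Equiv.ofBijective_apply, hσ]
  rw [hsub, Matrix.det_permute', map_mul]
  rcases Int.units_eq_one_or (Equiv.Perm.sign e) with h1 | h1
  · rw [h1]; simp
  · rw [h1]; simp

/-- image of an updated injective selection: `t[c ← j]` selects `insert j (image t \ {t c})` when `j ∉ image t`. [bookkeeping] -/
theorem image_update_eq {m K : ℕ} {t : Fin m → Fin K} (ht : Function.Injective t) (c : Fin m) {j : Fin K}
    (hj : j ∉ univ.image t) : univ.image (Function.update t c j) = insert j ((univ.image t).erase (t c)) := by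
  ext x
  simp only [Finset.mem_image, Finset.mem_univ, true_and, Finset.mem_insert, Finset.mem_erase]
  constructor
  · rintro ⟨c', hc'⟩
    by_cases h : c' = c
    · subst h
      rw [Function.update_self] at hc'
      exact Or.inl hc'.symm
    · rw [Function.update_of_ne h] at hc'
      refine Or.inr ⟨?_, c', hc'⟩
      intro hx
      rw [← hc'] at hx
      exact h (ht hx)
  · rintro (rfl | ⟨hx, c', hc'⟩)
    · exact ⟨c, Function.update_self _ _ _⟩
    · refine ⟨c', ?_⟩
      have h : c' ≠ c := by
        rintro rfl
        exact hx hc'.symm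
      rw [Function.update_of_ne h, hc']

/-- an updated injective selection with a fresh letter is injective. [bookkeeping] -/
theorem update_injective {m K : ℕ} {t : Fin m → Fin K} (ht : Function.Injective t) (c : Fin m) {j : Fin K}
    (hj : j ∉ univ.image t) : Function.Injective (Function.update t c j) := by
  intro c₁ c₂ h12
  by_cases h1 : c₁ = c
  · by_cases h2 : c₂ = c
    · rw [h1, h2]
    · subst h1
      rw [Function.update_self, Function.update_of_ne h2] at h12
      exact absurd (Finset.mem_image_of_mem t (Finset.mem_univ c₂)) (h12 ▸ hj)
  · by_cases h2 : c₂ = c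
    · subst h2
      rw [Function.update_self, Function.update_of_ne h1] at h12
      exact absurd (Finset.mem_image_of_mem t (Finset.mem_univ c₁)) (h12.symm ▸ hj)
    · rw [Function.update_of_ne h1, Function.update_of_ne h2] at h12
      exact ht h12

/-! ## §3 The exchange inequality of the rank-one coefficients -/

/-- the non-archimedean Grassmann–Plücker exchange for two column SELECTIONS: some letter of `t_B` can be swapped against the pivot
`t_A c` without decreasing the product of the `v ∘ det`. [folklore] -/
theorem exists_exchange_colSel (v : AbsoluteValue F ℝ) (hv : IsNonarchimedean v) {m K : ℕ} (hm : 0 < m) (u : Fin K → Fin m → F)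
    (tA tB : Fin m → Fin K) (c : Fin m) :
    ∃ j' : Fin m, v (Matrix.det (Matrix.of fun r c' => u (tA c') r)) * v (Matrix.det (Matrix.of fun r c' => u (tB c') r))
      ≤ v (Matrix.det (Matrix.of fun r c' => u (Function.update tA c (tB j') c') r))
        * v (Matrix.det (Matrix.of fun r c' => u (Function.update tB j' (tA c) c') r)) := by
  obtain ⟨j', hj'⟩ := exists_absdet_mul_le_exchange v hv hm (Matrix.of fun r c' => u (tA c') r)
    (Matrix.of fun r c' => u (tB c') r) c
  refine ⟨j', ?_⟩
  have e1 : (fun r => (Matrix.of fun r c' => u (tB c') r) r j') = fun r => u (tB j') r := rfl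
  have e2 : (fun r => (Matrix.of fun r c' => u (tA c') r) r c) = fun r => u (tA c) r := rfl
  rw [e1, e2, updateCol_colSel, updateCol_colSel] at hj'
  exact hj'

/-- product of letter valuations over the image of a strictly monotone selection. [bookkeeping] -/
theorem prod_image_eq_prod_of_strictMono {m K : ℕ} (g : Fin K → ℝ) (t : Fin m → Fin K) (ht : StrictMono t) :
    ∏ l ∈ univ.image t, g l = ∏ i, g (t i) := by
  rw [Finset.prod_image]
  intro i _ j _ h
  exact ht.injective h

/-- **the coefficient valuation of an `m`-SET** (dissociated `d`): `v(c_S) = (Π_{l∈S} v(ε_l)) · v(det U_t)²` for ANY injective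
selection `t` of `S` (sorted or not). [bookkeeping on `absoluteValue_coeff_det_rankOnePencil` + `absdet_colSel_eq_of_image_eq`] -/
theorem absoluteValue_coeff_set (v : AbsoluteValue F ℝ) (m K : ℕ) (d : Fin K → ℕ) (ε : Fin K → F) (u : Fin K → Fin m → F)
    (hdiss : ∀ t t' : Fin m → Fin K, StrictMono t → StrictMono t' → ∑ i, d (t i) = ∑ i, d (t' i) → t = t')
    {t : Fin m → Fin K} (ht : Function.Injective t) :
    v ((Matrix.det (∑ l, ((X : F[X]) ^ d l) • (ε l • Matrix.vecMulVec (u l) (u l)).map (C : F →+* F[X]))).coeff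
        (∑ l ∈ univ.image t, d l))
      = (∏ l ∈ univ.image t, v (ε l)) * v (Matrix.det (Matrix.of fun r c => u (t c) r)) ^ 2 := by
  have hcard : (univ.image t).card = m := by
    rw [Finset.card_image_of_injective _ ht, Finset.card_univ, Fintype.card_fin]
  obtain ⟨t₀, ht₀, himg⟩ := exists_strictMono_image_eq (univ.image t) hcard
  rw [← himg, sum_image_eq_sum_of_strictMono d t₀ ht₀, absoluteValue_coeff_det_rankOnePencil m K d ε u hdiss t₀ ht₀ v,
    prod_image_eq_prod_of_strictMono _ t₀ ht₀, absdet_colSel_eq_of_image_eq v u ht himg.symm]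

/-- **THE VALUATED-MATROID EXCHANGE INEQUALITY of the rank-one lacunary determinant** (non-archimedean `v`, dissociated `d`): for
`m`-sets `A`, `B` of letters whose exponents carry NONZERO coefficients and `i ∈ A \ B`, some `j ∈ B \ A` has
`v(c_A) · v(c_B) ≤ v(c_{A − i + j}) · v(c_{B − j + i})`.  The nonvanishing hypotheses `hA0`, `hB0` are load-bearing: sets with zero
coefficient (a zero letter or a singular minor) are simply OUTSIDE the valuated family (`−∞` in Dress–Wenzel's convention).  Sibling in the
tree: the abstract exchange axiom `…LacunarySymmetroidMatrixDescartes.NegSquaresTropical.IsValuation` (18050 negsquares port).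
[Grassmann–Plücker / Dress–Wenzel: `S ↦ ord det(u_S)` is a valuated matroid] -/
theorem exchange_coeff_rankOnePencil (v : AbsoluteValue F ℝ) (hv : IsNonarchimedean v) (m K : ℕ) (d : Fin K → ℕ) (ε : Fin K → F)
    (u : Fin K → Fin m → F)
    (hdiss : ∀ t t' : Fin m → Fin K, StrictMono t → StrictMono t' → ∑ i, d (t i) = ∑ i, d (t' i) → t = t')
    (A B : Finset (Fin K)) (hA : A.card = m) (hB : B.card = m)
    (hA0 : (Matrix.det (∑ l, ((X : F[X]) ^ d l) • (ε l • Matrix.vecMulVec (u l) (u l)).map (C : F →+* F[X]))).coeff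
        (∑ l ∈ A, d l) ≠ 0)
    (hB0 : (Matrix.det (∑ l, ((X : F[X]) ^ d l) • (ε l • Matrix.vecMulVec (u l) (u l)).map (C : F →+* F[X]))).coeff
        (∑ l ∈ B, d l) ≠ 0)
    (i : Fin K) (hi : i ∈ A \ B) :
    ∃ j ∈ B \ A,
      v ((Matrix.det (∑ l, ((X : F[X]) ^ d l) • (ε l • Matrix.vecMulVec (u l) (u l)).map (C : F →+* F[X]))).coeff (∑ l ∈ A, d l))
        * v ((Matrix.det (∑ l, ((X : F[X]) ^ d l) • (ε l • Matrix.vecMulVec (u l) (u l)).map (C : F →+* F[X]))).coeff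
            (∑ l ∈ B, d l))
      ≤ v ((Matrix.det (∑ l, ((X : F[X]) ^ d l) • (ε l • Matrix.vecMulVec (u l) (u l)).map (C : F →+* F[X]))).coeff
            (∑ l ∈ insert j (A.erase i), d l))
        * v ((Matrix.det (∑ l, ((X : F[X]) ^ d l) • (ε l • Matrix.vecMulVec (u l) (u l)).map (C : F →+* F[X]))).coeff
            (∑ l ∈ insert i (B.erase j), d l)) := by
  set f : F[X] := Matrix.det (∑ l, ((X : F[X]) ^ d l) • (ε l • Matrix.vecMulVec (u l) (u l)).map (C : F →+* F[X])) with hf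
  obtain ⟨hiA, hiB⟩ := Finset.mem_sdiff.1 hi
  -- sorted selections of A and B, the pivot position of i
  obtain ⟨tA, htA, hAimg⟩ := exists_strictMono_image_eq A hA
  obtain ⟨tB, htB, hBimg⟩ := exists_strictMono_image_eq B hB
  have hm : 0 < m := by
    rw [← hA]
    exact Finset.card_pos.2 ⟨i, hiA⟩
  have hic : i ∈ univ.image tA := hAimg.symm ▸ hiA
  obtain ⟨c, -, hc⟩ := Finset.mem_image.1 hic
  subst hc
  -- coefficient valuations of A and B; the minors are nonzero
  have hvA := absoluteValue_coeff_set v m K d ε u hdiss htA.injective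
  have hvB := absoluteValue_coeff_set v m K d ε u hdiss htB.injective
  rw [hAimg] at hvA
  rw [hBimg] at hvB
  have hdetA : 0 < v (Matrix.det (Matrix.of fun r c => u (tA c) r)) := by
    refine lt_of_le_of_ne (v.nonneg _) fun h0 => hA0 ?_
    have h1 : v (f.coeff (∑ l ∈ A, d l)) = 0 := by rw [hvA, ← h0]; ring
    exact (AbsoluteValue.eq_zero v).1 h1
  have hdetB : 0 < v (Matrix.det (Matrix.of fun r c => u (tB c) r)) := by
    refine lt_of_le_of_ne (v.nonneg _) fun h0 => hB0 ?_
    have h1 : v (f.coeff (∑ l ∈ B, d l)) = 0 := by rw [hvB, ← h0]; ring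
    exact (AbsoluteValue.eq_zero v).1 h1
  -- the Grassmann–Plücker exchange
  obtain ⟨j', hj'⟩ := exists_exchange_colSel v hv hm u tA tB c
  have hjB : tB j' ∈ B := hBimg ▸ Finset.mem_image_of_mem tB (Finset.mem_univ j')
  by_cases hjA : tB j' ∈ A
  · -- the new letter is already in A (elsewhere than the pivot): repeated column, contradiction
    exfalso
    have hji : tB j' ≠ tA c := fun h => hiB (h ▸ hjB)
    have hjc : tB j' ∈ univ.image tA := hAimg.symm ▸ hjA
    obtain ⟨c₀, -, hc₀⟩ := Finset.mem_image.1 hjc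
    have hc₀c : c₀ ≠ c := by
      rintro rfl
      exact hji hc₀.symm
    rw [det_colSel_update_eq_zero u tA c c₀ hc₀c (tB j') hc₀, map_zero, zero_mul] at hj'
    exact absurd hj' (not_le.2 (mul_pos hdetA hdetB))
  · refine ⟨tB j', Finset.mem_sdiff.2 ⟨hjB, hjA⟩, ?_⟩
    -- the two updated selections select A − i + j and B − j + i
    have hjimg : tB j' ∉ univ.image tA := hAimg.symm ▸ hjA
    have hiimg : tA c ∉ univ.image tB := hBimg.symm ▸ hiB
    have hinjA' := update_injective htA.injective c hjimg
    have hinjB' := update_injective htB.injective j' hiimg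
    have himgA' : univ.image (Function.update tA c (tB j')) = insert (tB j') (A.erase (tA c)) := by
      rw [image_update_eq htA.injective c hjimg, hAimg]
    have himgB' : univ.image (Function.update tB j' (tA c)) = insert (tA c) (B.erase (tB j')) := by
      rw [image_update_eq htB.injective j' hiimg, hBimg]
    have hvA' := absoluteValue_coeff_set v m K d ε u hdiss hinjA'
    have hvB' := absoluteValue_coeff_set v m K d ε u hdiss hinjB'
    rw [himgA'] at hvA'
    rw [himgB'] at hvB'
    rw [hvA, hvB, hvA', hvB']
    -- the letter products agree, the minors obey the exchange
    have hjA' : tB j' ∉ A.erase (tA c) := fun h => hjA (Finset.mem_of_mem_erase h)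
    have hiB' : tA c ∉ B.erase (tB j') := fun h => hiB (Finset.mem_of_mem_erase h)
    have hP : (∏ l ∈ insert (tB j') (A.erase (tA c)), v (ε l)) * (∏ l ∈ insert (tA c) (B.erase (tB j')), v (ε l))
        = (∏ l ∈ A, v (ε l)) * ∏ l ∈ B, v (ε l) := by
      rw [Finset.prod_insert hjA', Finset.prod_insert hiB', ← Finset.mul_prod_erase A (fun l => v (ε l)) hiA,
        ← Finset.mul_prod_erase B (fun l => v (ε l)) hjB]
      ring
    have hsq := pow_le_pow_left₀ (mul_nonneg (v.nonneg _) (v.nonneg _)) hj' 2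
    have hPnn : 0 ≤ (∏ l ∈ A, v (ε l)) * ∏ l ∈ B, v (ε l) :=
      mul_nonneg (Finset.prod_nonneg fun l _ => v.nonneg _) (Finset.prod_nonneg fun l _ => v.nonneg _)
    calc (∏ l ∈ A, v (ε l)) * v (Matrix.det (Matrix.of fun r c => u (tA c) r)) ^ 2
          * ((∏ l ∈ B, v (ε l)) * v (Matrix.det (Matrix.of fun r c => u (tB c) r)) ^ 2)
        = ((∏ l ∈ A, v (ε l)) * ∏ l ∈ B, v (ε l)) * (v (Matrix.det (Matrix.of fun r c => u (tA c) r))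
            * v (Matrix.det (Matrix.of fun r c => u (tB c) r))) ^ 2 := by ring
      _ ≤ ((∏ l ∈ A, v (ε l)) * ∏ l ∈ B, v (ε l))
            * (v (Matrix.det (Matrix.of fun r c' => u (Function.update tA c (tB j') c') r))
              * v (Matrix.det (Matrix.of fun r c' => u (Function.update tB j' (tA c) c') r))) ^ 2 :=
          mul_le_mul_of_nonneg_left hsq hPnn
      _ = _ := by rw [← hP]; ring

end Summit.ValiantsHypothesis.ValiantsHypothesis.Theorems.KPlusLogSqLaw.ValDoor
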